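import Mathlib
import Summits.Ventures.HodgeRepro.Tier4.Line1.AdelicSingle
import Summits.Ventures.HodgeRepro.Tier4.Line4.AtInfinitePlace
import Summits.Ventures.HodgeRepro.Tier4.Common.MixedPlaneKType
import Summits.Ventures.HodgeRepro.Tier4.Common.RowWeights

/-!
# Tier4/Line4/LocalAssembly — the slice `G_{w₀} = atPlace W w₀` IS the local unitary group `U(W)(k_{w₀})`:
a local `4 × 4` matrix at `w₀` placed in `G(𝔸)` («`m` at `w₀`, `1` elsewhere»), and the continuous isomorphism
`atPlace W w₀ ≃ₜ* localUnitary W w₀`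

Blind re-derivation cell `pub-hodge-repro`, Tier 4 «prove the step» (README §9–§10), seat t4-L4-p2 (prover, LINE L4,
gen 5; cut C2 of C-COMMON-SL2BALL stage C, plan-4 g5 S15544 / typer-2 S15525 (i), statement S15613 (M1)).  Tree path
`lean/Summits/Ventures/HodgeRepro/Tier4/Line4/LocalAssembly.lean`.  Mathlib-level; no literature.  Imports: L2-p2's
`Line1/AdelicSingle` (`singleInf w₀ : k_{w₀} →ₙ+* 𝔸_k`, «`c` at `w₀`, `0` elsewhere», and `embMat s N = 1 + (N − 1).map s`
with `mapMatrix_embMat_self` / `mapMatrix_embMat_zero`), this seat's `Line4/AtInfinitePlace` (`mat_ext`: an adelic matrix is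
determined by its components; `compInf_adMat`, `compFin_adMat`; `GA.ext_mat`), typer-2's `Common/MixedPlaneKType`
(`atPlace`) and `Common/RowWeights` (`continuous_mat_entry`).

THE CONSTRUCTION.  `atInfLocal w₀ A := embMat (singleInf k w₀) A` is the adelic `4 × 4` matrix with component `A` at the
infinite place `w₀` and `1` at every other place (`compInf_atInfLocal_self`, `compInf_atInfLocal_ne`, `compFin_atInfLocal`);
it is multiplicative, unital, compatible with transposition, and continuous in `A`.  `localUnitary W w₀` is the subgroup
`U(W)(k_{w₀}) = {m ∈ GL₄(k_{w₀}) | m Ω_{w₀} = Ω_{w₀} m, m B_{w₀} mᵀ = B_{w₀}}` (`Ω_{w₀}`, `B_{w₀}` = the rational matrices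
read in `k_{w₀}`).  For `m ∈ U(W)(k_{w₀})` the unit `atInfLocal w₀ m` lies in `U(W)(𝔸_k)` — both relations are checked
place by place through `mat_ext`: at `w₀` they are `m`'s, elsewhere they are `1`'s — giving the homomorphism
`gaAtInfLocal : localUnitary W w₀ →* GA W` with image in `atPlace W w₀` and `w₀`-component `m`.  Conversely the
`w₀`-component of any `g ∈ G(𝔸)` lies in `U(W)(k_{w₀})` (the adelic relations read through the ring homomorphism
`adComponentInf`), giving `componentAt : atPlace W w₀ →* localUnitary W w₀`.  The two are mutually inverse on the slice
(an element supported at `w₀` is determined by its `w₀`-component: `mat_ext` again) and continuous, hence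

  **`sliceEquiv W w₀ : atPlace W w₀ ≃ₜ* localUnitary W w₀`.**

Consumers: `Line4/SliceModel` (the row plane at a real CM place: `localUnitary ≃ₜ* U(J)`) and `Line4/SliceBallGrowth`
(stage C of SL2BALL: `ψ : U(1) × SL(2, ℝ) →* atPlace W w₀` through this equivalence).

Nothing here says anything about the status of the Hodge conjecture for CM abelian varieties, which is NOT proved
(HC_CM is NOT proved by anyone in this repository).
-/

set_option autoImplicit false

noncomputable section

namespace Summit.Ventures.HodgeRepro.Tier4.Line4

open Summit.Ventures.HodgeRepro.Tier4.Common Summit.Ventures.HodgeRepro.Tier4.Line1 NumberField Matrix Topology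
  IsDedekindDomain

open scoped Classical

/-! ## 1. A local matrix placed at `w₀` -/

section Placed

variable {k : Type} [Field k] [NumberField k]

/-- **A local `4 × 4` matrix placed at `w₀`**: the adelic matrix `1 + (A − 1).map (singleInf w₀)` — component `A` at `w₀`,
`1` at every other place. -/
def atInfLocal (w₀ : InfinitePlace k) (A : Matrix (Fin 4) (Fin 4) w₀.Completion) : M4 k :=
  embMat (singleInf k w₀) A

/-- The component of `atInfLocal w₀ A` at `w₀` is `A`. -/
theorem compInf_atInfLocal_self (w₀ : InfinitePlace k) (A : Matrix (Fin 4) (Fin 4) w₀.Completion) :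
    (adComponentInf k w₀).mapMatrix (atInfLocal w₀ A) = A := by
  rw [RingHom.mapMatrix_apply]
  exact mapMatrix_embMat_self (adComponentInf k w₀) (singleInf k w₀) (adComponentInf_singleInf_same k w₀) A

/-- The component of `atInfLocal w₀ A` at an infinite place `w ≠ w₀` is `1`. -/
theorem compInf_atInfLocal_ne {w₀ w : InfinitePlace k} (h : w ≠ w₀) (A : Matrix (Fin 4) (Fin 4) w₀.Completion) :
    (adComponentInf k w).mapMatrix (atInfLocal w₀ A) = 1 := by
  rw [RingHom.mapMatrix_apply]
  exact mapMatrix_embMat_zero (adComponentInf k w) (singleInf k w₀) (fun c => adComponentInf_singleInf_of_ne k h c) A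

/-- The components of `atInfLocal w₀ A` at the finite places are `1`. -/
theorem compFin_atInfLocal (w₀ : InfinitePlace k) (v : HeightOneSpectrum (𝓞 k))
    (A : Matrix (Fin 4) (Fin 4) w₀.Completion) : (adComponentFin k v).mapMatrix (atInfLocal w₀ A) = 1 := by
  rw [RingHom.mapMatrix_apply]
  exact mapMatrix_embMat_zero (adComponentFin k v) (singleInf k w₀) (fun c => adComponentFin_singleInf k w₀ v c) A

/-- `atInfLocal` is multiplicative. -/
theorem atInfLocal_mul (w₀ : InfinitePlace k) (A B : Matrix (Fin 4) (Fin 4) w₀.Completion) :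
    atInfLocal w₀ (A * B) = atInfLocal w₀ A * atInfLocal w₀ B :=
  embMat_mul (singleInf k w₀) A B

/-- `atInfLocal 1 = 1`. -/
theorem atInfLocal_one (w₀ : InfinitePlace k) : atInfLocal w₀ (1 : Matrix (Fin 4) (Fin 4) w₀.Completion) = 1 :=
  embMat_one (singleInf k w₀)

/-- The transpose of `atInfLocal A` is `atInfLocal Aᵀ`. -/
theorem atInfLocal_transpose (w₀ : InfinitePlace k) (A : Matrix (Fin 4) (Fin 4) w₀.Completion) :
    (atInfLocal w₀ A)ᵀ = atInfLocal w₀ Aᵀ := by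
  unfold atInfLocal embMat
  rw [Matrix.transpose_add, Matrix.transpose_one, ← Matrix.transpose_map, Matrix.transpose_sub,
    Matrix.transpose_one]

/-- `singleInf w₀` is continuous. -/
theorem continuous_singleInf (w₀ : InfinitePlace k) : Continuous (singleInf k w₀) := by
  show Continuous fun c : w₀.Completion =>
    ((Pi.single w₀ c : (w : InfinitePlace k) → w.Completion), (0 : FiniteAdeleRing (𝓞 k) k))
  exact (continuous_single w₀).prodMk continuous_const

/-- `atInfLocal w₀` is continuous in the local matrix. -/
theorem continuous_atInfLocal (w₀ : InfinitePlace k) :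
    Continuous fun A : Matrix (Fin 4) (Fin 4) w₀.Completion => atInfLocal w₀ A := by
  unfold atInfLocal embMat
  exact continuous_const.add ((continuous_id.sub continuous_const).matrix_map (continuous_singleInf w₀))

end Placed

/-! ## 2. The local unitary group `U(W)(k_{w₀})` and the placed element of `G(𝔸)` -/

section LocalUnitary

variable {k : Type} [Field k] [NumberField k] (W : PlaneData k) (w₀ : InfinitePlace k)

/-- The rational matrix `Ω` read in `k_{w₀}`. -/
abbrev omegaAt : Matrix (Fin 4) (Fin 4) w₀.Completion := W.Ω.map (algebraMap k w₀.Completion)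

/-- The rational Gram matrix `B` read in `k_{w₀}`. -/
abbrev gramAt : Matrix (Fin 4) (Fin 4) w₀.Completion := W.B.map (algebraMap k w₀.Completion)

/-- **The local unitary group `U(W)(k_{w₀})`**: the invertible `4 × 4` matrices over `k_{w₀}` commuting with `Ω_{w₀}` and
preserving the form `B_{w₀}` (the local twin of typer-2's `unitaryGroup`). -/
def localUnitary : Subgroup (GL (Fin 4) w₀.Completion) where
  carrier := {m | (m : Matrix (Fin 4) (Fin 4) w₀.Completion) * omegaAt W w₀ = omegaAt W w₀ * m ∧
    (m : Matrix (Fin 4) (Fin 4) w₀.Completion) * gramAt W w₀ * (m : Matrix (Fin 4) (Fin 4) w₀.Completion)ᵀ =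
      gramAt W w₀}
  one_mem' := by simp
  mul_mem' := by
    rintro g h ⟨hg1, hg2⟩ ⟨hh1, hh2⟩
    refine ⟨?_, ?_⟩
    · simp only [Units.val_mul]
      rw [Matrix.mul_assoc, hh1, ← Matrix.mul_assoc, hg1, Matrix.mul_assoc]
    · simp only [Units.val_mul, Matrix.transpose_mul]
      calc (g : Matrix (Fin 4) (Fin 4) w₀.Completion) * h * gramAt W w₀ *
            ((h : Matrix (Fin 4) (Fin 4) w₀.Completion)ᵀ * (g : Matrix (Fin 4) (Fin 4) w₀.Completion)ᵀ)
          = (g : Matrix (Fin 4) (Fin 4) w₀.Completion) *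
            ((h : Matrix (Fin 4) (Fin 4) w₀.Completion) * gramAt W w₀ * (h : Matrix (Fin 4) (Fin 4) w₀.Completion)ᵀ) *
              (g : Matrix (Fin 4) (Fin 4) w₀.Completion)ᵀ := by
            simp only [Matrix.mul_assoc]
        _ = gramAt W w₀ := by rw [hh2, hg2]
  inv_mem' := by
    rintro g ⟨hg1, hg2⟩
    have h1 : ((g⁻¹ : GL (Fin 4) w₀.Completion) : Matrix (Fin 4) (Fin 4) w₀.Completion) * g = 1 := Units.inv_mul g
    have h2 : (g : Matrix (Fin 4) (Fin 4) w₀.Completion) * (g⁻¹ : GL (Fin 4) w₀.Completion) = 1 := Units.mul_inv g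
    refine ⟨?_, ?_⟩
    · calc ((g⁻¹ : GL (Fin 4) w₀.Completion) : Matrix (Fin 4) (Fin 4) w₀.Completion) * omegaAt W w₀
          = ((g⁻¹ : GL (Fin 4) w₀.Completion) : Matrix (Fin 4) (Fin 4) w₀.Completion) * omegaAt W w₀ *
              ((g : Matrix (Fin 4) (Fin 4) w₀.Completion) * (g⁻¹ : GL (Fin 4) w₀.Completion)) := by
            rw [h2, Matrix.mul_one]
        _ = ((g⁻¹ : GL (Fin 4) w₀.Completion) : Matrix (Fin 4) (Fin 4) w₀.Completion) *
              ((g : Matrix (Fin 4) (Fin 4) w₀.Completion) * omegaAt W w₀) * (g⁻¹ : GL (Fin 4) w₀.Completion) := by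
            rw [hg1]; simp only [Matrix.mul_assoc]
        _ = omegaAt W w₀ * (g⁻¹ : GL (Fin 4) w₀.Completion) := by
            rw [← Matrix.mul_assoc, h1, Matrix.one_mul]
    · have h3 : (g : Matrix (Fin 4) (Fin 4) w₀.Completion)ᵀ *
          ((g⁻¹ : GL (Fin 4) w₀.Completion) : Matrix (Fin 4) (Fin 4) w₀.Completion)ᵀ = 1 := by
        rw [← Matrix.transpose_mul, h1, Matrix.transpose_one]
      calc ((g⁻¹ : GL (Fin 4) w₀.Completion) : Matrix (Fin 4) (Fin 4) w₀.Completion) * gramAt W w₀ *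
            ((g⁻¹ : GL (Fin 4) w₀.Completion) : Matrix (Fin 4) (Fin 4) w₀.Completion)ᵀ
          = ((g⁻¹ : GL (Fin 4) w₀.Completion) : Matrix (Fin 4) (Fin 4) w₀.Completion) *
            ((g : Matrix (Fin 4) (Fin 4) w₀.Completion) * gramAt W w₀ * (g : Matrix (Fin 4) (Fin 4) w₀.Completion)ᵀ) *
              ((g⁻¹ : GL (Fin 4) w₀.Completion) : Matrix (Fin 4) (Fin 4) w₀.Completion)ᵀ := by rw [hg2]
        _ = (((g⁻¹ : GL (Fin 4) w₀.Completion) : Matrix (Fin 4) (Fin 4) w₀.Completion) * g) * gramAt W w₀ *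
              ((g : Matrix (Fin 4) (Fin 4) w₀.Completion)ᵀ *
                ((g⁻¹ : GL (Fin 4) w₀.Completion) : Matrix (Fin 4) (Fin 4) w₀.Completion)ᵀ) := by
            simp only [Matrix.mul_assoc]
        _ = gramAt W w₀ := by rw [h1, h3, Matrix.one_mul, Matrix.mul_one]

omit [NumberField k] in
/-- Membership in the local unitary group, unfolded. -/
theorem mem_localUnitary (m : GL (Fin 4) w₀.Completion) : m ∈ localUnitary W w₀ ↔
    (m : Matrix (Fin 4) (Fin 4) w₀.Completion) * omegaAt W w₀ = omegaAt W w₀ * m ∧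
      (m : Matrix (Fin 4) (Fin 4) w₀.Completion) * gramAt W w₀ * (m : Matrix (Fin 4) (Fin 4) w₀.Completion)ᵀ =
        gramAt W w₀ :=
  Iff.rfl

/-- **The placed unit**: `m ∈ GL₄(k_{w₀})` as the element «`m` at `w₀`, `1` elsewhere» of `GL₄(𝔸_k)`. -/
def placedUnit : GL (Fin 4) w₀.Completion →* GL4 k := Units.map (embMatHom (singleInf k w₀))

/-- The matrix of the placed unit. -/
theorem coe_placedUnit (m : GL (Fin 4) w₀.Completion) : ((placedUnit w₀ m : GL4 k) : M4 k) = atInfLocal w₀ m := rfl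

/-- The matrix of the inverse of the placed unit. -/
theorem coe_placedUnit_inv (m : GL (Fin 4) w₀.Completion) :
    (((placedUnit w₀ m)⁻¹ : GL4 k) : M4 k) = atInfLocal w₀ (m⁻¹ : GL (Fin 4) w₀.Completion) := rfl

/-- `placedUnit` is continuous. -/
theorem continuous_placedUnit : Continuous (placedUnit w₀) := by
  refine Units.continuous_iff.2 ⟨?_, ?_⟩
  · exact (continuous_atInfLocal w₀).comp Units.continuous_val
  · exact (continuous_atInfLocal w₀).comp Units.continuous_coe_inv

/-- **The placed unit of a local unitary matrix is adelic unitary**: both relations hold place by place. -/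
theorem placedUnit_mem_unitaryGroup {m : GL (Fin 4) w₀.Completion} (hm : m ∈ localUnitary W w₀) :
    placedUnit w₀ m ∈ unitaryGroup W := by
  obtain ⟨hΩ, hB⟩ := (mem_localUnitary W w₀ m).1 hm
  rw [mem_unitaryGroup, coe_placedUnit]
  refine ⟨mat_ext (fun w => ?_) (fun v => ?_), ?_⟩
  · rw [map_mul, map_mul, compInf_adMat]
    by_cases hw : w = w₀
    · subst hw
      rw [compInf_atInfLocal_self]
      exact hΩ
    · rw [compInf_atInfLocal_ne hw, Matrix.one_mul, Matrix.mul_one]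
  · rw [map_mul, map_mul, compFin_atInfLocal, Matrix.one_mul, Matrix.mul_one]
  · rw [atInfLocal_transpose]
    refine mat_ext (fun w => ?_) (fun v => ?_)
    · rw [map_mul, map_mul, compInf_adMat]
      by_cases hw : w = w₀
      · subst hw
        rw [compInf_atInfLocal_self, compInf_atInfLocal_self]
        exact hB
      · rw [compInf_atInfLocal_ne hw, compInf_atInfLocal_ne hw, Matrix.one_mul, Matrix.mul_one]
    · rw [map_mul, map_mul, compFin_atInfLocal, compFin_atInfLocal, Matrix.one_mul, Matrix.mul_one]

/-- **The placed element of `G(𝔸)`**: `gaAtInfLocal : U(W)(k_{w₀}) →* G(𝔸)`, «`m` at `w₀`, `1` elsewhere». -/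
def gaAtInfLocal : localUnitary W w₀ →* GA W :=
  ((placedUnit w₀).restrict (localUnitary W w₀)).codRestrict (unitaryGroup W)
    (fun m => placedUnit_mem_unitaryGroup W w₀ m.2)

/-- The adelic matrix of the placed element. -/
theorem gaAtInfLocal_mat (m : localUnitary W w₀) : GA.mat W (gaAtInfLocal W w₀ m) = atInfLocal w₀ (m : GL (Fin 4) w₀.Completion) :=
  rfl

/-- The finite components of the placed element are `1`. -/
theorem finiteComponent_gaAtInfLocal (m : localUnitary W w₀) (v : HeightOneSpectrum (𝓞 k)) :
    GA.finiteComponent W v (gaAtInfLocal W w₀ m) = 1 := by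
  apply Units.ext
  show (adComponentFin k v).mapMatrix (atInfLocal w₀ (m : GL (Fin 4) w₀.Completion)) = 1
  exact compFin_atInfLocal w₀ v _

/-- The infinite components of the placed element away from `w₀` are `1`. -/
theorem infiniteComponent_gaAtInfLocal_of_ne (m : localUnitary W w₀) {w : InfinitePlace k} (hw : w ≠ w₀) :
    GA.infiniteComponent W w (gaAtInfLocal W w₀ m) = 1 := by
  apply Units.ext
  show (adComponentInf k w).mapMatrix (atInfLocal w₀ (m : GL (Fin 4) w₀.Completion)) = 1
  exact compInf_atInfLocal_ne hw _

/-- **The `w₀`-component of the placed element is `m`.** -/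
theorem infiniteComponent_gaAtInfLocal_self (m : localUnitary W w₀) :
    GA.infiniteComponent W w₀ (gaAtInfLocal W w₀ m) = (m : GL (Fin 4) w₀.Completion) := by
  apply Units.ext
  show (adComponentInf k w₀).mapMatrix (atInfLocal w₀ (m : GL (Fin 4) w₀.Completion)) = _
  exact compInf_atInfLocal_self w₀ _

/-- The placed element is supported at `w₀`. -/
theorem gaAtInfLocal_mem_atPlace (m : localUnitary W w₀) : gaAtInfLocal W w₀ m ∈ atPlace W w₀ :=
  ⟨fun v => finiteComponent_gaAtInfLocal W w₀ m v, fun _ hw => infiniteComponent_gaAtInfLocal_of_ne W w₀ m hw⟩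

/-- `gaAtInfLocal` is continuous. -/
theorem continuous_gaAtInfLocal : Continuous (gaAtInfLocal W w₀) :=
  Continuous.subtype_mk ((continuous_placedUnit w₀).comp continuous_subtype_val) _

end LocalUnitary

/-! ## 3. The `w₀`-component of `G(𝔸)` lands in `U(W)(k_{w₀})`; the slice equivalence -/

section Slice

variable {k : Type} [Field k] [NumberField k] (W : PlaneData k) (w₀ : InfinitePlace k)

/-- The matrix of the `w₀`-component of `g` is the `w₀`-component of its matrix. -/
theorem coe_infiniteComponent (g : GA W) :
    ((GA.infiniteComponent W w₀ g : GL (Fin 4) w₀.Completion) : Matrix (Fin 4) (Fin 4) w₀.Completion) =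
      (adComponentInf k w₀).mapMatrix (GA.mat W g) := rfl

/-- **The `w₀`-component of any `g ∈ G(𝔸)` is locally unitary**: the adelic relations read at `w₀`. -/
theorem infiniteComponent_mem_localUnitary (g : GA W) : GA.infiniteComponent W w₀ g ∈ localUnitary W w₀ := by
  obtain ⟨hΩ, hB⟩ := (mem_unitaryGroup W _).1 g.2
  rw [mem_localUnitary, coe_infiniteComponent]
  refine ⟨?_, ?_⟩
  · have h := congrArg (adComponentInf k w₀).mapMatrix hΩ
    rw [map_mul, map_mul, compInf_adMat] at h
    exact h
  · have h := congrArg (adComponentInf k w₀).mapMatrix hB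
    rw [map_mul, map_mul, compInf_adMat, RingHom.mapMatrix_apply, RingHom.mapMatrix_apply, Matrix.transpose_map] at h
    rw [RingHom.mapMatrix_apply]
    exact h

/-- **The component map on the slice**: `componentAt : atPlace W w₀ →* U(W)(k_{w₀})`. -/
def componentAt : atPlace W w₀ →* localUnitary W w₀ :=
  ((GA.infiniteComponent W w₀).restrict (atPlace W w₀)).codRestrict (localUnitary W w₀)
    (fun g => infiniteComponent_mem_localUnitary W w₀ g)

/-- The value of `componentAt`. -/
theorem coe_componentAt (g : atPlace W w₀) :
    ((componentAt W w₀ g : localUnitary W w₀) : GL (Fin 4) w₀.Completion) = GA.infiniteComponent W w₀ (g : GA W) :=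
  rfl

/-- The component projection `adComponentInf k w₀` is continuous (evaluation at `w₀` of the archimedean factor). -/
theorem continuous_adComponentInf' : Continuous (adComponentInf k w₀) :=
  (continuous_apply w₀).comp continuous_fst

/-- `GA.infiniteComponent W w₀` is continuous. -/
theorem continuous_infiniteComponent : Continuous (GA.infiniteComponent W w₀) := by
  refine Units.continuous_iff.2 ⟨?_, ?_⟩
  · show Continuous fun g : GA W => (adComponentInf k w₀).mapMatrix (GA.mat W g)
    simp only [RingHom.mapMatrix_apply]
    exact continuous_matrix fun i j => (continuous_adComponentInf' w₀).comp (continuous_mat_entry W i j)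
  · have h : (fun g : GA W => ((GA.infiniteComponent W w₀ g)⁻¹ : GL (Fin 4) w₀.Completion).val) =
        fun g : GA W => (adComponentInf k w₀).mapMatrix (GA.mat W g⁻¹) := by
      funext g
      rw [← map_inv]
      rfl
    rw [h]
    simp only [RingHom.mapMatrix_apply]
    exact continuous_matrix fun i j =>
      (continuous_adComponentInf' w₀).comp ((continuous_mat_entry W i j).comp continuous_inv)

/-- `componentAt` is continuous. -/
theorem continuous_componentAt : Continuous (componentAt W w₀) :=
  Continuous.subtype_mk ((continuous_infiniteComponent W w₀).comp continuous_subtype_val) _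

/-- **An element supported at `w₀` is the placed element of its `w₀`-component.** -/
theorem gaAtInfLocal_componentAt (g : atPlace W w₀) : gaAtInfLocal W w₀ (componentAt W w₀ g) = (g : GA W) := by
  obtain ⟨hfin, hinf⟩ := g.2
  apply GA.ext_mat
  rw [gaAtInfLocal_mat, coe_componentAt, coe_infiniteComponent]
  refine mat_ext (fun w => ?_) (fun v => ?_)
  · by_cases hw : w = w₀
    · subst hw
      exact compInf_atInfLocal_self w _
    · rw [compInf_atInfLocal_ne hw]
      have h := congrArg Units.val (hinf w hw)
      exact h.symm
  · rw [compFin_atInfLocal]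
    have h := congrArg Units.val (hfin v)
    exact h.symm

/-- **The `w₀`-component of the placed element of `m` is `m`.** -/
theorem componentAt_gaAtInfLocal (m : localUnitary W w₀) :
    componentAt W w₀ ⟨gaAtInfLocal W w₀ m, gaAtInfLocal_mem_atPlace W w₀ m⟩ = m := by
  apply Subtype.ext
  rw [coe_componentAt]
  exact infiniteComponent_gaAtInfLocal_self W w₀ m

/-- **THE SLICE EQUIVALENCE**: `atPlace W w₀ ≃ₜ* U(W)(k_{w₀})` — the elements of `G(𝔸)` supported at the infinite place
`w₀` are exactly the local unitary matrices at `w₀`, as topological groups. -/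
def sliceEquiv : atPlace W w₀ ≃ₜ* localUnitary W w₀ where
  toFun := componentAt W w₀
  invFun m := ⟨gaAtInfLocal W w₀ m, gaAtInfLocal_mem_atPlace W w₀ m⟩
  left_inv g := Subtype.ext (gaAtInfLocal_componentAt W w₀ g)
  right_inv m := componentAt_gaAtInfLocal W w₀ m
  map_mul' := (componentAt W w₀).map_mul
  continuous_toFun := continuous_componentAt W w₀
  continuous_invFun := Continuous.subtype_mk (continuous_gaAtInfLocal W w₀) _

/-- The value of the slice equivalence. -/
theorem coe_sliceEquiv_apply (g : atPlace W w₀) :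
    ((sliceEquiv W w₀ g : localUnitary W w₀) : GL (Fin 4) w₀.Completion) = GA.infiniteComponent W w₀ (g : GA W) :=
  rfl

/-- The value of the inverse slice equivalence. -/
theorem coe_sliceEquiv_symm_apply (m : localUnitary W w₀) :
    (((sliceEquiv W w₀).symm m : atPlace W w₀) : GA W) = gaAtInfLocal W w₀ m :=
  rfl

end Slice

end Summit.Ventures.HodgeRepro.Tier4.Line4

end
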